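import Summits.PneNP.PneNP.Theorems.SzkEntropyPeaThreeNotInPSocketBridge
import Summits.PneNP.PneNP.Theorems.SzkEntropyPeaThreeNotInPSocketEncodeFP
import Summits.PneNP.PneNP.Theorems.SzkEntropyPeaThreeNotInPKillSwitch
import Literature.Computability.Complexity.PromiseProofs
import Literature.Computability.Complexity.PromiseBPPClosureProofs
import HarnessLib

/-!
# Route SzkEntropy, crux `PeaThreeNotInP` (stmt-PneNP-10776), line `SketchIdeator3`, socket rider:
# `PEABP ≤ₚ PEA 3` and the entropy-approximation socket

* `PEABP_polyTimeReducible_PEA_three : PEABP ≤ₚ PEA 3` — Dvir–Gutfreund–Rothblum–Vadhan Thm 4.6 on the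
  `PEA` side for deterministic branching programs: the typed semantics `PEABPInst.toPEA_mem_yes/no`
  (Literature, `BranchingProgramEntropy.lean`) + the `CodeFP` program `stub_toPEARawFP` + the bridge
  `rawOf_toPEA` / `encode_eq_peabpE`;
* **socket**: `peaThreeNotInP_of_PEABP_not_mem : PEABP ∉ PromiseP → PeaThreeNotInP` and its randomised
  form `not_peaThreeMemBPP_of_PEABP : PEABP ∉ PromiseBPP' → ¬ PeaThreeMemBPP`.

Sources: Z. Dvir, D. Gutfreund, G. N. Rothblum, S. Vadhan, ECCC TR10-160 (2010), Thm 4.5–4.6,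
Claim 4.4; O. Goldreich, *On promise problems* (2006), Def. 1.2–1.4.
-/

namespace Summit.PneNP.PneNP.Cruxes.PeaThreeNotInP.SocketBP

set_option linter.dupNamespace false -- `Summit.PneNP.PneNP.…`: summit = sub-problem name (D-0017)

open _root_.Computability Finset
open Literature.InformationTheory.Entropy
open Literature.Computability.Complexity Literature.Computability.Complexity.RandPoly
open Literature.Computability.Cryptography (toInput fnList freshBDDs encodeBDDsMap encodeBDDs_fst_eq)
open CodeFP (natE pairE rawE listE)
open Summit.PneNP.PneNP.Theses.SzkEntropy (PeaThreeNotInP PeaThreeMemBPP)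
open Summit.PneNP.PneNP.Theorems (szkEntropy_peaThreeNotInP_iff szkEntropy_peaThreeMemBPP_iff)

/-! ### `PEABP ≤ₚ PEA 3` -/

/-- **DGRV Thm 4.6 (`PEA` side, deterministic branching programs): entropy approximation for
branching-program samplers Karp-reduces to `PEA 3`.**
[cite: DvirGutfreundRothblumVadhan2010, Thm 4.6] -/
theorem PEABP_polyTimeReducible_PEA_three : PEABP.PolyTimeReducible (PEA 3) := by
  obtain ⟨F, hF, hFr⟩ := stub_toPEARawFP
  have hred : ∀ I : PEABPInst,
      F (PEABPInst.encoding.encode I) = PEAInst.encoding.encode (PEABPInst.toPEA I) := by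
    intro I
    rw [encode_eq_peabpE, hFr, encode_eq_instE, rawOf_toPEA]
  refine ⟨F, hF, fun w hw => ?_, fun w hw => ?_⟩
  · have hw' := hw
    obtain ⟨I, -, rfl⟩ : ∃ I, I ∈ _ ∧ PEABPInst.encoding.encode I = w := hw
    rw [hred]
    exact PEABPInst.toPEA_mem_yes hw'
  · have hw' := hw
    obtain ⟨I, -, rfl⟩ : ∃ I, I ∈ _ ∧ PEABPInst.encoding.encode I = w := hw
    rw [hred]
    exact PEABPInst.toPEA_mem_no hw'


/-- **Entropy-approximation socket: hardness of `PEABP` gives the crux** (`PEA 3 ∈ PromiseP` would put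
`PEABP` in `PromiseP` through the Karp reduction). [cite: DvirGutfreundRothblumVadhan2010, Thm 4.6] -/
theorem peaThreeNotInP_of_PEABP_not_mem (h : PEABP ∉ PromiseP) : PeaThreeNotInP := by
  rw [szkEntropy_peaThreeNotInP_iff]
  intro h3
  exact h (PromiseProblem.mem_PromiseP_of_polyTimeReducible_holds PEABP_polyTimeReducible_PEA_three h3)

/-- **Randomised form**: `PEABP ∉ PromiseBPP'` gives `PEA 3 ∉ PromiseBPP'`, i.e. `¬ PeaThreeMemBPP`
(hence the crux, by kill-switch exhaustiveness). [cite: DvirGutfreundRothblumVadhan2010, Thm 4.6] -/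
theorem not_peaThreeMemBPP_of_PEABP (h : PEABP ∉ PromiseBPP') : ¬ PeaThreeMemBPP := by
  rw [szkEntropy_peaThreeMemBPP_iff]
  intro h3
  exact h (PromiseProblem.mem_PromiseBPP'_of_polyTimeReducible_holds' PEABP_polyTimeReducible_PEA_three h3)

end Summit.PneNP.PneNP.Cruxes.PeaThreeNotInP.SocketBP
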